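import Mathlib.FieldTheory.IsAlgClosed.Basic
import Mathlib.Data.Nat.Factorial.Basic
import Mathlib.LinearAlgebra.Basis.VectorSpace
import Mathlib.Algebra.Algebra.Rat
import HarnessLib

/-!
# Rational powers in algebraically closed fields and homomorphic extensions of partial
exponential maps

Toolkit for the construction of exponential fields by extending a homomorphism
`E : (Λ, +) → (Ωˣ, ·)` on a `ℚ`-subspace `Λ` of a field `Ω` one generator at a time (J. Kirby,
*Finitely presented exponential fields*, Algebra & Number Theory 7 (2013), §2: a partial
exponential field is a `ℚ`-subspace with a homomorphism to the multiplicative group, and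
extensions are specified by "a choice of division sequence", i.e. a coherent system of roots of
the new values; M. Bays, J. Kirby 2018, §3.3). In an algebraically closed field every non-zero
`y` admits a coherent system of roots, hence a homomorphism `ρ : ℚ → Ωˣ` with `ρ 1 = y`
(`exists_ratPow`); and a homomorphism `E : Ω → Ω` (additive to multiplicative) can be modified off
a subspace `Λ` so as to take a prescribed non-zero value at a vector `x ∉ Λ` while keeping its
values on `Λ` (`exists_hom_extend_single`).

## References

* J. Kirby, *Finitely presented exponential fields*, Algebra & Number Theory 7 (2013) 943–980:
  §2 (partial exponential fields, division sequences).
* M. Bays, J. Kirby, *Pseudo-exponential maps, variants, and quasiminimality*, Algebra & Number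
  Theory 12 (2018): §3.3.
-/

noncomputable section

namespace Literature.FieldTheory.AlgClosed

variable {Ω : Type*} [Field Ω]

/-! ### Coherent roots and rational powers -/

/-- A **coherent system of roots** of `y`: `s 0 = y` and `(s (n+1))^(n+2) = s n`, so that
`(s n)^((n+1)!) = y` (Kirby 2013, Def. 2.5, indexed by factorials). It exists in an algebraically
closed field. [cite: Kirby2013FPEF, Def. 2.5] -/
theorem exists_coherentRoots [IsAlgClosed Ω] (y : Ω) :
    ∃ s : ℕ → Ω, s 0 = y ∧ ∀ n, s (n + 1) ^ (n + 2) = s n := by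
  have step : ∀ (n : ℕ) (z : Ω), ∃ w : Ω, w ^ (n + 2) = z := fun n z =>
    IsAlgClosed.exists_pow_nat_eq z (by omega)
  choose r hr using step
  let s : ℕ → Ω := fun n => Nat.rec y (fun n z => r n z) n
  refine ⟨s, rfl, fun n => ?_⟩
  exact hr n (s n)

/-- In a coherent system of roots, `(s n)^((n+1)!) = y`. [folklore] -/
theorem coherentRoots_pow_factorial {y : Ω} {s : ℕ → Ω} (h0 : s 0 = y)
    (hs : ∀ n, s (n + 1) ^ (n + 2) = s n) (n : ℕ) : s n ^ (n + 1).factorial = y := by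
  induction n with
  | zero => simpa using h0
  | succ n ih => rw [Nat.factorial_succ, pow_mul, hs n, ih]

/-- In a coherent system of roots, `(s m)^((m+1)!/(n+1)!) = s n` for `n ≤ m`. [folklore] -/
theorem coherentRoots_pow_div {s : ℕ → Ω} (hs : ∀ n, s (n + 1) ^ (n + 2) = s n) {n m : ℕ}
    (hnm : n ≤ m) : s m ^ ((m + 1).factorial / (n + 1).factorial) = s n := by
  induction m, hnm using Nat.le_induction with
  | base => rw [Nat.div_self (Nat.factorial_pos _), pow_one]
  | succ m hnm ih =>
    have hdvd : (n + 1).factorial ∣ (m + 1).factorial := Nat.factorial_dvd_factorial (by omega)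
    rw [Nat.factorial_succ (m + 1), Nat.mul_div_assoc _ hdvd, pow_mul, hs m, ih]

/-- Members of a coherent system of roots of a non-zero element are non-zero. [folklore] -/
theorem coherentRoots_ne_zero {y : Ω} (hy : y ≠ 0) {s : ℕ → Ω} (h0 : s 0 = y)
    (hs : ∀ n, s (n + 1) ^ (n + 2) = s n) (n : ℕ) : s n ≠ 0 := fun h => by
  have := coherentRoots_pow_factorial h0 hs n
  rw [h, zero_pow (Nat.factorial_pos _).ne'] at this
  exact hy this.symm

/-- The integer exponent `q · (n+1)!` of a rational `q` at a level `n` with `q.den ∣ (n+1)!`.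
[folklore] -/
def levelExp (q : ℚ) (n : ℕ) : ℤ := q.num * (((n + 1).factorial / q.den : ℕ) : ℤ)

/-- `levelExp q n = q · (n+1)!` in `ℚ` when `q.den ∣ (n+1)!`. [folklore] -/
theorem levelExp_cast {q : ℚ} {n : ℕ} (h : q.den ∣ (n + 1).factorial) :
    (levelExp q n : ℚ) = q * (n + 1).factorial := by
  rw [levelExp, Int.cast_mul, Int.cast_natCast, Nat.cast_div h (Nat.cast_ne_zero.2 q.den_nz)]
  conv_rhs => rw [← Rat.num_div_den q]
  field_simp

/-- `q.den ∣ (n+1)!` as soon as `q.den ≤ n + 1`. [folklore] -/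
theorem den_dvd_factorial (q : ℚ) {n : ℕ} (h : q.den ≤ n + 1) : q.den ∣ (n + 1).factorial :=
  Nat.dvd_factorial q.den_pos h

/-- **Rational powers**: in an algebraically closed field, every `y ≠ 0` is `ρ 1` for a
homomorphism `ρ : (ℚ, +) → (Ωˣ, ·)` (raise a coherent system of roots of `y` to integer powers).
[cite: Kirby2013FPEF, §2 (division sequences)] -/
theorem exists_ratPow [IsAlgClosed Ω] {y : Ω} (hy : y ≠ 0) :
    ∃ ρ : ℚ → Ω, ρ 1 = y ∧ (∀ q q', ρ (q + q') = ρ q * ρ q') ∧ ∀ q, ρ q ≠ 0 := by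
  obtain ⟨s, h0, hs⟩ := exists_coherentRoots y
  have hs0 := coherentRoots_ne_zero hy h0 hs
  -- the value at level `n`
  let val : ℚ → ℕ → Ω := fun q n => s n ^ levelExp q n
  -- independence of the level
  have hval : ∀ (q : ℚ) {n m : ℕ}, q.den ∣ (n + 1).factorial → n ≤ m → val q m = val q n := by
    intro q n m hn hnm
    have hm : q.den ∣ (m + 1).factorial := hn.trans (Nat.factorial_dvd_factorial (by omega))
    have hdvd : (n + 1).factorial ∣ (m + 1).factorial := Nat.factorial_dvd_factorial (by omega)
    have hexp : levelExp q m = levelExp q n * (((m + 1).factorial / (n + 1).factorial : ℕ) : ℤ) := by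
      have hc : (((m + 1).factorial / (n + 1).factorial : ℕ) : ℚ) * ((n + 1).factorial : ℚ) =
          ((m + 1).factorial : ℚ) := by
        exact_mod_cast Nat.div_mul_cancel hdvd
      have h1 : (levelExp q m : ℚ) =
          ((levelExp q n * (((m + 1).factorial / (n + 1).factorial : ℕ) : ℤ) : ℤ) : ℚ) := by
        rw [Int.cast_mul, Int.cast_natCast, levelExp_cast hm, levelExp_cast hn, mul_assoc,
          mul_comm ((n + 1).factorial : ℚ), hc]
      exact_mod_cast h1
    simp only [val]
    rw [hexp, zpow_mul, ← coherentRoots_pow_div hs hnm, ← zpow_natCast, ← zpow_mul, ← zpow_mul, mul_comm]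
  refine ⟨fun q => val q (q.den - 1), ?_, fun q q' => ?_, fun q => zpow_ne_zero _ (hs0 _)⟩
  · simp only [val, levelExp, Rat.num_one, Rat.den_one, one_mul]
    have : s (1 - 1) ^ (((0 + 1).factorial / 1 : ℕ) : ℤ) = y := by simp [h0]
    simpa using this
  · -- compare at the common level `N = q.den + q'.den + (q+q').den`
    show val (q + q') ((q + q').den - 1) = val q (q.den - 1) * val q' (q'.den - 1)
    set N : ℕ := q.den + q'.den + (q + q').den with hN
    have hq : q.den ∣ (q.den - 1 + 1).factorial := den_dvd_factorial q (by have := q.den_pos; omega)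
    have hq' : q'.den ∣ (q'.den - 1 + 1).factorial := den_dvd_factorial q' (by have := q'.den_pos; omega)
    have hqq' : (q + q').den ∣ ((q + q').den - 1 + 1).factorial :=
      den_dvd_factorial (q + q') (by have := (q + q').den_pos; omega)
    rw [← hval q hq (by omega : q.den - 1 ≤ N), ← hval q' hq' (by omega : q'.den - 1 ≤ N),
      ← hval (q + q') hqq' (by omega : (q + q').den - 1 ≤ N)]
    simp only [val]
    rw [← zpow_add₀ (hs0 N)]
    congr 1
    have hNq : q.den ∣ (N + 1).factorial := den_dvd_factorial q (by omega)
    have hNq' : q'.den ∣ (N + 1).factorial := den_dvd_factorial q' (by omega)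
    have hNqq' : (q + q').den ∣ (N + 1).factorial := den_dvd_factorial (q + q') (by omega)
    have : (levelExp (q + q') N : ℚ) = levelExp q N + levelExp q' N := by
      rw [levelExp_cast hNqq', levelExp_cast hNq, levelExp_cast hNq', add_mul]
    exact_mod_cast this

/-- Consequences of being a homomorphism `ℚ → Ωˣ`: value at `0`. [folklore] -/
theorem ratPow_zero {ρ : ℚ → Ω} (hadd : ∀ q q', ρ (q + q') = ρ q * ρ q') (hne : ∀ q, ρ q ≠ 0) :
    ρ 0 = 1 := by
  have := hadd 0 0
  rw [add_zero] at this
  exact (mul_eq_left₀ (hne 0)).1 this.symm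

/-- `ρ (n • q) = (ρ q)^n`. [folklore] -/
theorem ratPow_nsmul {ρ : ℚ → Ω} (hadd : ∀ q q', ρ (q + q') = ρ q * ρ q') (hne : ∀ q, ρ q ≠ 0)
    (n : ℕ) (q : ℚ) : ρ (n • q) = ρ q ^ n := by
  induction n with
  | zero => rw [zero_smul, pow_zero, ratPow_zero hadd hne]
  | succ n ih => rw [succ_nsmul, hadd, ih, pow_succ]

/-- `ρ n = y^n` for natural `n` when `ρ 1 = y`. [folklore] -/
theorem ratPow_natCast {ρ : ℚ → Ω} {y : Ω} (h1 : ρ 1 = y) (hadd : ∀ q q', ρ (q + q') = ρ q * ρ q')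
    (hne : ∀ q, ρ q ≠ 0) (n : ℕ) : ρ n = y ^ n := by
  have := ratPow_nsmul hadd hne n 1
  rwa [nsmul_eq_mul, mul_one, h1] at this

/-- `ρ (-q) = (ρ q)⁻¹`. [folklore] -/
theorem ratPow_neg {ρ : ℚ → Ω} (hadd : ∀ q q', ρ (q + q') = ρ q * ρ q') (hne : ∀ q, ρ q ≠ 0)
    (q : ℚ) : ρ (-q) = (ρ q)⁻¹ := by
  have := hadd q (-q)
  rw [add_neg_cancel, ratPow_zero hadd hne] at this
  exact (eq_inv_of_mul_eq_one_right this.symm)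

/-- `ρ m = y^m` for integers `m` when `ρ 1 = y`. [folklore] -/
theorem ratPow_intCast {ρ : ℚ → Ω} {y : Ω} (h1 : ρ 1 = y) (hadd : ∀ q q', ρ (q + q') = ρ q * ρ q')
    (hne : ∀ q, ρ q ≠ 0) (m : ℤ) : ρ m = y ^ m := by
  cases m with
  | ofNat n => rw [Int.ofNat_eq_natCast, Int.cast_natCast, ratPow_natCast h1 hadd hne, zpow_natCast]
  | negSucc n =>
    rw [Int.cast_negSucc, ratPow_neg hadd hne, ratPow_natCast h1 hadd hne, zpow_negSucc]

/-- `(ρ q)^(q.den) = y^(q.num)`: rational powers are radicals of integer powers. [folklore] -/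
theorem ratPow_pow_den {ρ : ℚ → Ω} {y : Ω} (h1 : ρ 1 = y) (hadd : ∀ q q', ρ (q + q') = ρ q * ρ q')
    (hne : ∀ q, ρ q ≠ 0) (q : ℚ) : ρ q ^ q.den = y ^ q.num := by
  rw [← ratPow_nsmul hadd hne, nsmul_eq_mul, mul_comm, Rat.mul_den_eq_num,
    ratPow_intCast h1 hadd hne]

/-! ### Extending a homomorphism by one generator -/

/-- **Modifying a homomorphism off a subspace, one generator at a time** (Kirby 2013, §2: an
extension of a partial exponential map is a choice of value and division sequence for a new
generator). Let `E : Ω → Ω` be a homomorphism from `(Ω, +)` to `(Ω, ·)`, `Λ ≤ Ω` a `ℚ`-subspace,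
`x ∉ Λ` and `y ≠ 0`. Then there are a homomorphism `E' : Ω → Ω` and rational powers `ρ` of `y`
(`ρ 1 = y`) with `E' (v + q • x) = E v · ρ q` for all `v ∈ Λ`, `q ∈ ℚ` — so `E' = E` on `Λ` and
`E' x = y`. (A `ℚ`-linear `G : Ω → Ω × ℚ` with `G v = (v, 0)` on `Λ` and `G x = (0, 1)` exists by
`LinearMap.exists_extend_of_notMem`; put `E' v = E (G v).1 · ρ (G v).2`.)
[cite: Kirby2013FPEF, §2] -/
theorem exists_hom_extend_single [IsAlgClosed Ω] [CharZero Ω] {E : Ω → Ω}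
    (hE : ∀ a b, E (a + b) = E a * E b) (Λ : Submodule ℚ Ω) {x : Ω} (hx : x ∉ Λ) {y : Ω}
    (hy : y ≠ 0) :
    ∃ (E' : Ω → Ω) (ρ : ℚ → Ω), ρ 1 = y ∧ (∀ q q', ρ (q + q') = ρ q * ρ q') ∧ (∀ q, ρ q ≠ 0) ∧
      (∀ a b, E' (a + b) = E' a * E' b) ∧ ∀ v ∈ Λ, ∀ q : ℚ, E' (v + q • x) = E v * ρ q := by
  obtain ⟨ρ, h1, hadd, hne⟩ := exists_ratPow hy
  -- the linear decomposition map
  let f : Λ →ₗ[ℚ] Ω × ℚ := LinearMap.prod Λ.subtype 0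
  obtain ⟨G, hGΛ, hGx⟩ := LinearMap.exists_extend_of_notMem f hx ((0 : Ω), (1 : ℚ))
  have hGv : ∀ v ∈ Λ, G v = (v, 0) := fun v hv => by
    have := LinearMap.congr_fun hGΛ ⟨v, hv⟩
    simpa [f] using this
  refine ⟨fun v => E (G v).1 * ρ (G v).2, ρ, h1, hadd, hne, fun a b => ?_, fun v hv q => ?_⟩
  · simp only [map_add, Prod.fst_add, Prod.snd_add, hE, hadd]
    ring
  · have : G (v + q • x) = (v, q) := by
      rw [map_add, map_smul, hGv v hv, hGx]
      ext <;> simp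
    simp only [this]

end Literature.FieldTheory.AlgClosed
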